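import Summits.CriticalPhenomena.PercolationContinuityZ3.Theorems.PercNearOneGluingNoHeavyLowerTailTerminalTwoSumCells
import Summits.CriticalPhenomena.PercolationContinuityZ3.Theorems.PercNearOneGluingNoHeavyLowerTailApexTwoSumPointwise
import HarnessLib

/-!
# `NoHeavyLowerTail` (stmt-CriticalPhenomena-4575) — 2-sums through a terminal (the `{b, v}`-cut), part 3:
# pointwise weight identities for the four R1 cells of a configuration glued along `{v, b}`

Support file (prover prim-gen-kcluster gen 72; `--supports stmt-CriticalPhenomena-4575`).  No definitions, no named facts, no sorries.
With `T = {v, b}` wired counts and the block-cell functions `F_σ(ζ) = 1_σ(ζ) q^{k^T(ζ)}` (X-states `x1 = {b, v ∈ C(a)}`, `x2 = {b ∈ C(a), v ∉}`,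
`x3 = {v ∈ C(a), b ∉}`; Y-cells = the six cells of `(v; b, c)` in `DY`), for every `ω` (weights vanish off `DX ∪ DY`):
`w_φ(ω) 1_T(ω) q^{k^T(∅)} = weight(ω)[F_1(F_t+F_uc+F_ua) + F_2F_t + F_3F_t + qF_2F_ua]`, `… 1_{U_b} … = weight[F_1(F_ub+F_s+F_n) + F_2F_ub + qF_2(F_uc+F_s+F_n) + F_3F_ub]`,
`… 1_{U_c} … = weight·q F_3 F_uc`, `… 1_S … = weight·q F_3 F_s` (the last one under the support hypothesis `c ∈ cl DY b`).
-/

noncomputable section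

namespace Summit.CriticalPhenomena.PercolationContinuityZ3.Theorems

namespace TerminalTwoSum

open Finset SimpleGraph Literature.Probability.Percolation Literature.Probability.Percolation.Gladkov
open Literature.Probability.Percolation.BHK2006 (weight)
open Literature.Probability.Percolation.DecisionTree (ind ind_of_mem ind_of_not_mem ind_nonneg)
open Literature.Probability.LatticeModels RefinedRowR3 ThreePointLB MeasureTheory
open scoped Classical

variable {V : Type*} [Fintype V]

/-! ### Transitivity in the `X`-block: `ApexTwoSum.arm_t1/2/3` (part 3 of the apex 2-sum) are reused below. -/

section Pointwise

variable {DX DY : Finset (Sym2 V)} {a b c v : V} (hab : a ≠ b) (hav : a ≠ v) (hac : a ≠ c) (hbc : b ≠ c) (hvc : v ≠ c)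
  (hvb : v ≠ b)
  (hsepD : ∀ x : V, (∃ e ∈ DX, x ∈ e) → (∃ e ∈ DY, x ∈ e) → (x = v ∨ x = b))
  (haY : ∀ e ∈ DY, a ∉ e) (hcX : ∀ e ∈ DX, c ∉ e)
  (w : Sym2 V → unitInterval) (q : ℝ) (hw : ∀ e, e ∉ (↑DX ∪ ↑DY : Set (Sym2 V)) → (w e : ℝ) = 0)
include hab hav hac hbc hvc hvb hsepD haY hcX hw

/-- **Pointwise decomposition, cell `T = {b, c ∈ C(a)}`**. [this work] -/
theorem pt_T (ω : BondConfig V) :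
    rcWeightW w q ∅ ω * ind {η : BondConfig V | b ∈ cl η.toFinset a ∧ c ∈ cl η.toFinset a} ω * q ^ clusterCount (∅ : BondConfig V) ({v, b} : Set V) =
      weight (fun e => (w e : ℝ)) ω * ((ind {η : BondConfig V | b ∈ cl η.toFinset a ∧ v ∈ cl η.toFinset a} (ω ∩ ↑DX) * q ^ clusterCount (ω ∩ ↑DX) ({v, b} : Set V)) * ((ind {η : BondConfig V | b ∈ cl η.toFinset v ∧ c ∈ cl η.toFinset v} (ω \ ↑DX) * q ^ clusterCount (ω \ ↑DX) ({v, b} : Set V)) + (ind {η : BondConfig V | b ∉ cl η.toFinset v ∧ c ∈ cl η.toFinset v} (ω \ ↑DX) * q ^ clusterCount (ω \ ↑DX) ({v, b} : Set V)) + (ind {η : BondConfig V | b ∉ cl η.toFinset v ∧ c ∉ cl η.toFinset v ∧ c ∈ cl η.toFinset b} (ω \ ↑DX) * q ^ clusterCount (ω \ ↑DX) ({v, b} : Set V))) + (ind {η : BondConfig V | b ∈ cl η.toFinset a ∧ v ∉ cl η.toFinset a} (ω ∩ ↑DX) * q ^ clusterCount (ω ∩ ↑DX) ({v, b} : Set V))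 * (ind {η : BondConfig V | b ∈ cl η.toFinset v ∧ c ∈ cl η.toFinset v} (ω \ ↑DX) * q ^ clusterCount (ω \ ↑DX) ({v, b} : Set V)) + (ind {η : BondConfig V | b ∉ cl η.toFinset a ∧ v ∈ cl η.toFinset a} (ω ∩ ↑DX) * q ^ clusterCount (ω ∩ ↑DX) ({v, b} : Set V)) * (ind {η : BondConfig V | b ∈ cl η.toFinset v ∧ c ∈ cl η.toFinset v} (ω \ ↑DX) * q ^ clusterCount (ω \ ↑DX) ({v, b} : Set V)) + q * ((ind {η : BondConfig V | b ∈ cl η.toFinset a ∧ v ∉ cl η.toFinset a} (ω ∩ ↑DX) * q ^ clusterCount (ω ∩ ↑DX) ({v, b} : Set V)) * (ind {η : BondConfig V | b ∉ cl η.toFinset v ∧ c ∉ cl η.toFinset v ∧ c ∈ cl η.toFinset b} (ω \ ↑DX) * q ^ clusterCount (ω \ ↑DX) ({v, b} : Set V)))) := by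
  by_cases hω : ω ⊆ ↑DX ∪ ↑DY
  swap
  · obtain ⟨e, heω, heD⟩ := Set.not_subset.1 hω
    have h0 := ApexTwoSum.weight_eq_zero_of_mem_not_mem w hw heω heD
    unfold rcWeightW
    rw [h0]; ring
  have jb := glued_b_iff' hab hav hsepD haY hω
  have jv := glued_v_iff' hab hav hsepD haY hω
  have jc := glued_c_iff hac hbc hvc hsepD haY hcX hω
  have jbv := glued_vb_iff hsepD hω
  have hadd := ApexTwoSum.kT_add hsepD hω
  obtain ⟨t1Y, t2Y, t3Y⟩ := ThreeSum.trans_three (a := v) (b := b) (c := c) (ω \ (↑DX : Set (Sym2 V)))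
  have htab : ∀ r : ℝ, (((ω ∩ ↑DX) ∈ {η : BondConfig V | b ∈ cl η.toFinset v} ∨ (ω \ ↑DX) ∈ {η : BondConfig V | b ∈ cl η.toFinset v}) → r = 1) → (¬ ((ω ∩ ↑DX) ∈ {η : BondConfig V | b ∈ cl η.toFinset v} ∨ (ω \ ↑DX) ∈ {η : BondConfig V | b ∈ cl η.toFinset v}) → r = q) →
      ind {η : BondConfig V | b ∈ cl η.toFinset a ∧ c ∈ cl η.toFinset a} ω * r = (ind {η : BondConfig V | b ∈ cl η.toFinset a ∧ v ∈ cl η.toFinset a} (ω ∩ ↑DX)) * ((ind {η : BondConfig V | b ∈ cl η.toFinset v ∧ c ∈ cl η.toFinset v} (ω \ ↑DX)) + (ind {η : BondConfig V | b ∉ cl η.toFinset v ∧ c ∈ cl η.toFinset v} (ω \ ↑DX)) + (ind {η : BondConfig V | b ∉ cl η.toFinset v ∧ c ∉ cl η.toFinset v ∧ c ∈ cl η.toFinset b} (ω \ ↑DX))) + (ind {η : BondConfig V | b ∈ cl η.toFinset a ∧ v ∉ cl η.toFinset a} (ω ∩ ↑DX)) * (ind {η : BondConfig V | b ∈ cl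 η.toFinset v ∧ c ∈ cl η.toFinset v} (ω \ ↑DX)) + (ind {η : BondConfig V | b ∉ cl η.toFinset a ∧ v ∈ cl η.toFinset a} (ω ∩ ↑DX)) * (ind {η : BondConfig V | b ∈ cl η.toFinset v ∧ c ∈ cl η.toFinset v} (ω \ ↑DX)) + q * ((ind {η : BondConfig V | b ∈ cl η.toFinset a ∧ v ∉ cl η.toFinset a} (ω ∩ ↑DX)) * (ind {η : BondConfig V | b ∉ cl η.toFinset v ∧ c ∉ cl η.toFinset v ∧ c ∈ cl η.toFinset b} (ω \ ↑DX))) := by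
    intro r hr1 hrq
    exact table_T (fun h1 h2 => ApexTwoSum.arm_t1 (a := a) (h := b) (t := v) (ω ∩ ↑DX) h2 h1) (fun h1 h2 => ApexTwoSum.arm_t3 (a := a) (h := b) (t := v) (ω ∩ ↑DX) h1 h2)
      (fun h1 h2 => ApexTwoSum.arm_t2 (a := a) (h := b) (t := v) (ω ∩ ↑DX) h1 h2) t1Y t2Y t3Y
      (fun hnb hk => not_sepY_of_mem' (DY := DY) hω hnb hk) hr1 hrq
      (fun hf => ind_of_mem (show ω ∈ {η : BondConfig V | b ∈ cl η.toFinset a ∧ c ∈ cl η.toFinset a} from ⟨jb.2 hf.1, jc.2 (hf.2.imp (fun h => ⟨jb.2 h.1, h.2⟩) (fun h => ⟨jv.2 h.1, h.2⟩))⟩)) (fun hf => ind_of_not_mem (show ω ∉ {η : BondConfig V | b ∈ cl η.toFinset a ∧ c ∈ cl η.toFinset a} from fun hT => hf ⟨jb.1 hT.1, (jc.1 hT.2).imp (fun h => ⟨jb.1 h.1, h.2⟩) (fun h => ⟨jv.1 h.1, h.2⟩)⟩))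
      (fun hh => ind_of_mem hh) (fun hh => ind_of_not_mem hh)
      (fun hh => ind_of_mem hh) (fun hh => ind_of_not_mem hh)
      (fun hh => ind_of_mem hh) (fun hh => ind_of_not_mem hh)
      (fun hh => ind_of_mem hh) (fun hh => ind_of_not_mem hh)
      (fun hh => ind_of_mem hh) (fun hh => ind_of_not_mem hh)
      (fun hh => ind_of_mem hh) (fun hh => ind_of_not_mem hh)
  by_cases hG : b ∈ cl ω.toFinset v
  · have hk := ApexTwoSum.k_of_mem hvb ω hG
    have hpow : q ^ clusterCount ω ∅ * q ^ clusterCount (∅ : BondConfig V) ({v, b} : Set V) = q ^ clusterCount (ω ∩ ↑DX) ({v, b} : Set V) * q ^ clusterCount (ω \ ↑DX) ({v, b} : Set V) := by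
      rw [← pow_add, hk, hadd, pow_add]
    have ht := htab 1 (fun _ => rfl) (fun hn => absurd (jbv.1 hG) hn)
    unfold rcWeightW
    linear_combination (weight (fun e => (w e : ℝ)) ω * ind {η : BondConfig V | b ∈ cl η.toFinset a ∧ c ∈ cl η.toFinset a} ω) * hpow + (weight (fun e => (w e : ℝ)) ω * q ^ clusterCount (ω ∩ ↑DX) ({v, b} : Set V) * q ^ clusterCount (ω \ ↑DX) ({v, b} : Set V)) * ht
  · have hk := ApexTwoSum.k_of_not_mem hvb ω hG
    have hpow : q ^ clusterCount ω ∅ * q ^ clusterCount (∅ : BondConfig V) ({v, b} : Set V) = q * (q ^ clusterCount (ω ∩ ↑DX) ({v, b} : Set V) * q ^ clusterCount (ω \ ↑DX) ({v, b} : Set V)) := by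
      rw [← pow_add, hk, Nat.add_right_comm, hadd, pow_succ, pow_add]; ring
    have ht := htab q (fun hb => absurd (jbv.2 hb) hG) (fun _ => rfl)
    unfold rcWeightW
    linear_combination (weight (fun e => (w e : ℝ)) ω * ind {η : BondConfig V | b ∈ cl η.toFinset a ∧ c ∈ cl η.toFinset a} ω) * hpow + (weight (fun e => (w e : ℝ)) ω * q ^ clusterCount (ω ∩ ↑DX) ({v, b} : Set V) * q ^ clusterCount (ω \ ↑DX) ({v, b} : Set V)) * ht

/-- **Pointwise decomposition, cell `U_b`**. [this work] -/
theorem pt_Ub (ω : BondConfig V) :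
    rcWeightW w q ∅ ω * ind {η : BondConfig V | b ∈ cl η.toFinset a ∧ c ∉ cl η.toFinset a} ω * q ^ clusterCount (∅ : BondConfig V) ({v, b} : Set V) =
      weight (fun e => (w e : ℝ)) ω * ((ind {η : BondConfig V | b ∈ cl η.toFinset a ∧ v ∈ cl η.toFinset a} (ω ∩ ↑DX) * q ^ clusterCount (ω ∩ ↑DX) ({v, b} : Set V)) * ((ind {η : BondConfig V | b ∈ cl η.toFinset v ∧ c ∉ cl η.toFinset v} (ω \ ↑DX) * q ^ clusterCount (ω \ ↑DX) ({v, b} : Set V)) + (ind {η : BondConfig V | b ∉ cl η.toFinset v ∧ c ∉ cl η.toFinset v ∧ Sep DY (cl η.toFinset v) b c} (ω \ ↑DX) * q ^ clusterCount (ω \ ↑DX) ({v, b} : Set V)) + (ind {η : BondConfig V | b ∉ cl η.toFinset v ∧ c ∉ cl η.toFinset v ∧ c ∉ cl η.toFinset b ∧ ¬ Sep DY (cl η.toFinset v) b c} (ω \ ↑DX) * q ^ clusterCount (ω \ ↑DX) ({v, b} : Set V))) + (ind {η : BondConfig V | b ∈ cl η.toFinset a ∧ v ∉ cl η.toFinset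 a} (ω ∩ ↑DX) * q ^ clusterCount (ω ∩ ↑DX) ({v, b} : Set V)) * (ind {η : BondConfig V | b ∈ cl η.toFinset v ∧ c ∉ cl η.toFinset v} (ω \ ↑DX) * q ^ clusterCount (ω \ ↑DX) ({v, b} : Set V)) + q * ((ind {η : BondConfig V | b ∈ cl η.toFinset a ∧ v ∉ cl η.toFinset a} (ω ∩ ↑DX) * q ^ clusterCount (ω ∩ ↑DX) ({v, b} : Set V)) * ((ind {η : BondConfig V | b ∉ cl η.toFinset v ∧ c ∈ cl η.toFinset v} (ω \ ↑DX) * q ^ clusterCount (ω \ ↑DX) ({v, b} : Set V)) + (ind {η : BondConfig V | b ∉ cl η.toFinset v ∧ c ∉ cl η.toFinset v ∧ Sep DY (cl η.toFinset v) b c} (ω \ ↑DX) * q ^ clusterCount (ω \ ↑DX) ({v, b} : Set V)) + (ind {η : BondConfig V | b ∉ cl η.toFinset v ∧ c ∉ cl η.toFinset v ∧ c ∉ cl η.toFinset b ∧ ¬ Sep DY (cl η.toFinset v) b c} (ω \ ↑DX) * q ^ clusterCount (ω \ ↑DX) ({v, b} : Set V)))) + (ind {η : BondConfig V | b ∉ cl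 η.toFinset a ∧ v ∈ cl η.toFinset a} (ω ∩ ↑DX) * q ^ clusterCount (ω ∩ ↑DX) ({v, b} : Set V)) * (ind {η : BondConfig V | b ∈ cl η.toFinset v ∧ c ∉ cl η.toFinset v} (ω \ ↑DX) * q ^ clusterCount (ω \ ↑DX) ({v, b} : Set V))) := by
  by_cases hω : ω ⊆ ↑DX ∪ ↑DY
  swap
  · obtain ⟨e, heω, heD⟩ := Set.not_subset.1 hω
    have h0 := ApexTwoSum.weight_eq_zero_of_mem_not_mem w hw heω heD
    unfold rcWeightW
    rw [h0]; ring
  have jb := glued_b_iff' hab hav hsepD haY hω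
  have jv := glued_v_iff' hab hav hsepD haY hω
  have jc := glued_c_iff hac hbc hvc hsepD haY hcX hω
  have jbv := glued_vb_iff hsepD hω
  have hadd := ApexTwoSum.kT_add hsepD hω
  obtain ⟨t1Y, t2Y, t3Y⟩ := ThreeSum.trans_three (a := v) (b := b) (c := c) (ω \ (↑DX : Set (Sym2 V)))
  have htab : ∀ r : ℝ, (((ω ∩ ↑DX) ∈ {η : BondConfig V | b ∈ cl η.toFinset v} ∨ (ω \ ↑DX) ∈ {η : BondConfig V | b ∈ cl η.toFinset v}) → r = 1) → (¬ ((ω ∩ ↑DX) ∈ {η : BondConfig V | b ∈ cl η.toFinset v} ∨ (ω \ ↑DX) ∈ {η : BondConfig V | b ∈ cl η.toFinset v}) → r = q) →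
      ind {η : BondConfig V | b ∈ cl η.toFinset a ∧ c ∉ cl η.toFinset a} ω * r = (ind {η : BondConfig V | b ∈ cl η.toFinset a ∧ v ∈ cl η.toFinset a} (ω ∩ ↑DX)) * ((ind {η : BondConfig V | b ∈ cl η.toFinset v ∧ c ∉ cl η.toFinset v} (ω \ ↑DX)) + (ind {η : BondConfig V | b ∉ cl η.toFinset v ∧ c ∉ cl η.toFinset v ∧ Sep DY (cl η.toFinset v) b c} (ω \ ↑DX)) + (ind {η : BondConfig V | b ∉ cl η.toFinset v ∧ c ∉ cl η.toFinset v ∧ c ∉ cl η.toFinset b ∧ ¬ Sep DY (cl η.toFinset v) b c} (ω \ ↑DX))) + (ind {η : BondConfig V | b ∈ cl η.toFinset a ∧ v ∉ cl η.toFinset a} (ω ∩ ↑DX)) * (ind {η : BondConfig V | b ∈ cl η.toFinset v ∧ c ∉ cl η.toFinset v} (ω \ ↑DX)) + q * ((ind {η : BondConfig V | b ∈ cl η.toFinset a ∧ v ∉ cl η.toFinset a} (ω ∩ ↑DX)) * ((ind {η : BondConfig V | b ∉ cl η.toFinset v ∧ c ∈ cl η.toFinset v} (ω \ ↑DX)) +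 (ind {η : BondConfig V | b ∉ cl η.toFinset v ∧ c ∉ cl η.toFinset v ∧ Sep DY (cl η.toFinset v) b c} (ω \ ↑DX)) + (ind {η : BondConfig V | b ∉ cl η.toFinset v ∧ c ∉ cl η.toFinset v ∧ c ∉ cl η.toFinset b ∧ ¬ Sep DY (cl η.toFinset v) b c} (ω \ ↑DX)))) + (ind {η : BondConfig V | b ∉ cl η.toFinset a ∧ v ∈ cl η.toFinset a} (ω ∩ ↑DX)) * (ind {η : BondConfig V | b ∈ cl η.toFinset v ∧ c ∉ cl η.toFinset v} (ω \ ↑DX)) := by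
    intro r hr1 hrq
    exact table_Ub (fun h1 h2 => ApexTwoSum.arm_t1 (a := a) (h := b) (t := v) (ω ∩ ↑DX) h2 h1) (fun h1 h2 => ApexTwoSum.arm_t3 (a := a) (h := b) (t := v) (ω ∩ ↑DX) h1 h2)
      (fun h1 h2 => ApexTwoSum.arm_t2 (a := a) (h := b) (t := v) (ω ∩ ↑DX) h1 h2) t1Y t2Y t3Y
      (fun hnb hk => not_sepY_of_mem' (DY := DY) hω hnb hk) hr1 hrq
      (fun hf => ind_of_mem (show ω ∈ {η : BondConfig V | b ∈ cl η.toFinset a ∧ c ∉ cl η.toFinset a} from ⟨jb.2 hf.1, fun hc => hf.2 ((jc.1 hc).imp (fun h => ⟨jb.1 h.1, h.2⟩) (fun h => ⟨jv.1 h.1, h.2⟩))⟩)) (fun hf => ind_of_not_mem (show ω ∉ {η : BondConfig V | b ∈ cl η.toFinset a ∧ c ∉ cl η.toFinset a} from fun hU => hf ⟨jb.1 hU.1, fun hc => hU.2 (jc.2 (hc.imp (fun h => ⟨jb.2 h.1, h.2⟩) (fun h => ⟨jv.2 h.1, h.2⟩)))⟩))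
      (fun hh => ind_of_mem hh) (fun hh => ind_of_not_mem hh)
      (fun hh => ind_of_mem hh) (fun hh => ind_of_not_mem hh)
      (fun hh => ind_of_mem hh) (fun hh => ind_of_not_mem hh)
      (fun hh => ind_of_mem hh) (fun hh => ind_of_not_mem hh)
      (fun hh => ind_of_mem hh) (fun hh => ind_of_not_mem hh)
      (fun hh => ind_of_mem hh) (fun hh => ind_of_not_mem hh)
      (fun hh => ind_of_mem hh) (fun hh => ind_of_not_mem hh)
  by_cases hG : b ∈ cl ω.toFinset v
  · have hk := ApexTwoSum.k_of_mem hvb ω hG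
    have hpow : q ^ clusterCount ω ∅ * q ^ clusterCount (∅ : BondConfig V) ({v, b} : Set V) = q ^ clusterCount (ω ∩ ↑DX) ({v, b} : Set V) * q ^ clusterCount (ω \ ↑DX) ({v, b} : Set V) := by
      rw [← pow_add, hk, hadd, pow_add]
    have ht := htab 1 (fun _ => rfl) (fun hn => absurd (jbv.1 hG) hn)
    unfold rcWeightW
    linear_combination (weight (fun e => (w e : ℝ)) ω * ind {η : BondConfig V | b ∈ cl η.toFinset a ∧ c ∉ cl η.toFinset a} ω) * hpow + (weight (fun e => (w e : ℝ)) ω * q ^ clusterCount (ω ∩ ↑DX) ({v, b} : Set V) * q ^ clusterCount (ω \ ↑DX) ({v, b} : Set V)) * ht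
  · have hk := ApexTwoSum.k_of_not_mem hvb ω hG
    have hpow : q ^ clusterCount ω ∅ * q ^ clusterCount (∅ : BondConfig V) ({v, b} : Set V) = q * (q ^ clusterCount (ω ∩ ↑DX) ({v, b} : Set V) * q ^ clusterCount (ω \ ↑DX) ({v, b} : Set V)) := by
      rw [← pow_add, hk, Nat.add_right_comm, hadd, pow_succ, pow_add]; ring
    have ht := htab q (fun hb => absurd (jbv.2 hb) hG) (fun _ => rfl)
    unfold rcWeightW
    linear_combination (weight (fun e => (w e : ℝ)) ω * ind {η : BondConfig V | b ∈ cl η.toFinset a ∧ c ∉ cl η.toFinset a} ω) * hpow + (weight (fun e => (w e : ℝ)) ω * q ^ clusterCount (ω ∩ ↑DX) ({v, b} : Set V) * q ^ clusterCount (ω \ ↑DX) ({v, b} : Set V)) * ht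

/-- **Pointwise decomposition, cell `U_c`**. [this work] -/
theorem pt_Uc (ω : BondConfig V) :
    rcWeightW w q ∅ ω * ind {η : BondConfig V | b ∉ cl η.toFinset a ∧ c ∈ cl η.toFinset a} ω * q ^ clusterCount (∅ : BondConfig V) ({v, b} : Set V) =
      weight (fun e => (w e : ℝ)) ω * (q * ((ind {η : BondConfig V | b ∉ cl η.toFinset a ∧ v ∈ cl η.toFinset a} (ω ∩ ↑DX) * q ^ clusterCount (ω ∩ ↑DX) ({v, b} : Set V)) * (ind {η : BondConfig V | b ∉ cl η.toFinset v ∧ c ∈ cl η.toFinset v} (ω \ ↑DX) * q ^ clusterCount (ω \ ↑DX) ({v, b} : Set V)))) := by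
  by_cases hω : ω ⊆ ↑DX ∪ ↑DY
  swap
  · obtain ⟨e, heω, heD⟩ := Set.not_subset.1 hω
    have h0 := ApexTwoSum.weight_eq_zero_of_mem_not_mem w hw heω heD
    unfold rcWeightW
    rw [h0]; ring
  have jb := glued_b_iff' hab hav hsepD haY hω
  have jv := glued_v_iff' hab hav hsepD haY hω
  have jc := glued_c_iff hac hbc hvc hsepD haY hcX hω
  have jbv := glued_vb_iff hsepD hω
  have hadd := ApexTwoSum.kT_add hsepD hω
  obtain ⟨t1Y, t2Y, t3Y⟩ := ThreeSum.trans_three (a := v) (b := b) (c := c) (ω \ (↑DX : Set (Sym2 V)))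
  have htab : ∀ r : ℝ, (((ω ∩ ↑DX) ∈ {η : BondConfig V | b ∈ cl η.toFinset v} ∨ (ω \ ↑DX) ∈ {η : BondConfig V | b ∈ cl η.toFinset v}) → r = 1) → (¬ ((ω ∩ ↑DX) ∈ {η : BondConfig V | b ∈ cl η.toFinset v} ∨ (ω \ ↑DX) ∈ {η : BondConfig V | b ∈ cl η.toFinset v}) → r = q) →
      ind {η : BondConfig V | b ∉ cl η.toFinset a ∧ c ∈ cl η.toFinset a} ω * r = q * ((ind {η : BondConfig V | b ∉ cl η.toFinset a ∧ v ∈ cl η.toFinset a} (ω ∩ ↑DX)) * (ind {η : BondConfig V | b ∉ cl η.toFinset v ∧ c ∈ cl η.toFinset v} (ω \ ↑DX))) := by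
    intro r hr1 hrq
    exact table_Uc (fun h1 h2 => ApexTwoSum.arm_t1 (a := a) (h := b) (t := v) (ω ∩ ↑DX) h2 h1) (fun h1 h2 => ApexTwoSum.arm_t3 (a := a) (h := b) (t := v) (ω ∩ ↑DX) h1 h2)
      (fun h1 h2 => ApexTwoSum.arm_t2 (a := a) (h := b) (t := v) (ω ∩ ↑DX) h1 h2) t1Y t2Y t3Y
      (fun hnb hk => not_sepY_of_mem' (DY := DY) hω hnb hk) hr1 hrq
      (fun hf => ind_of_mem (show ω ∈ {η : BondConfig V | b ∉ cl η.toFinset a ∧ c ∈ cl η.toFinset a} from ⟨fun hb => hf.1 (jb.1 hb), jc.2 (hf.2.imp (fun h => ⟨jb.2 h.1, h.2⟩) (fun h => ⟨jv.2 h.1, h.2⟩))⟩)) (fun hf => ind_of_not_mem (show ω ∉ {η : BondConfig V | b ∉ cl η.toFinset a ∧ c ∈ cl η.toFinset a} from fun hU => hf ⟨fun hb => hU.1 (jb.2 hb), (jc.1 hU.2).imp (fun h => ⟨jb.1 h.1, h.2⟩) (fun h => ⟨jv.1 h.1, h.2⟩)⟩))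
      (fun hh => ind_of_mem hh) (fun hh => ind_of_not_mem hh)
      (fun hh => ind_of_mem hh) (fun hh => ind_of_not_mem hh)
  by_cases hG : b ∈ cl ω.toFinset v
  · have hk := ApexTwoSum.k_of_mem hvb ω hG
    have hpow : q ^ clusterCount ω ∅ * q ^ clusterCount (∅ : BondConfig V) ({v, b} : Set V) = q ^ clusterCount (ω ∩ ↑DX) ({v, b} : Set V) * q ^ clusterCount (ω \ ↑DX) ({v, b} : Set V) := by
      rw [← pow_add, hk, hadd, pow_add]
    have ht := htab 1 (fun _ => rfl) (fun hn => absurd (jbv.1 hG) hn)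
    unfold rcWeightW
    linear_combination (weight (fun e => (w e : ℝ)) ω * ind {η : BondConfig V | b ∉ cl η.toFinset a ∧ c ∈ cl η.toFinset a} ω) * hpow + (weight (fun e => (w e : ℝ)) ω * q ^ clusterCount (ω ∩ ↑DX) ({v, b} : Set V) * q ^ clusterCount (ω \ ↑DX) ({v, b} : Set V)) * ht
  · have hk := ApexTwoSum.k_of_not_mem hvb ω hG
    have hpow : q ^ clusterCount ω ∅ * q ^ clusterCount (∅ : BondConfig V) ({v, b} : Set V) = q * (q ^ clusterCount (ω ∩ ↑DX) ({v, b} : Set V) * q ^ clusterCount (ω \ ↑DX) ({v, b} : Set V)) := by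
      rw [← pow_add, hk, Nat.add_right_comm, hadd, pow_succ, pow_add]; ring
    have ht := htab q (fun hb => absurd (jbv.2 hb) hG) (fun _ => rfl)
    unfold rcWeightW
    linear_combination (weight (fun e => (w e : ℝ)) ω * ind {η : BondConfig V | b ∉ cl η.toFinset a ∧ c ∈ cl η.toFinset a} ω) * hpow + (weight (fun e => (w e : ℝ)) ω * q ^ clusterCount (ω ∩ ↑DX) ({v, b} : Set V) * q ^ clusterCount (ω \ ↑DX) ({v, b} : Set V)) * ht

/-- **Pointwise decomposition, separating cell `S`** (under the support hypothesis `c ∈ cl DY b`). [this work] -/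
theorem pt_S (HY : c ∈ cl DY b) (ω : BondConfig V) :
    rcWeightW w q ∅ ω * ind {η : BondConfig V | b ∉ cl η.toFinset a ∧ c ∉ cl η.toFinset a ∧ Sep (DX ∪ DY) (cl η.toFinset a) b c} ω * q ^ clusterCount (∅ : BondConfig V) ({v, b} : Set V) =
      weight (fun e => (w e : ℝ)) ω * (q * ((ind {η : BondConfig V | b ∉ cl η.toFinset a ∧ v ∈ cl η.toFinset a} (ω ∩ ↑DX) * q ^ clusterCount (ω ∩ ↑DX) ({v, b} : Set V)) * (ind {η : BondConfig V | b ∉ cl η.toFinset v ∧ c ∉ cl η.toFinset v ∧ Sep DY (cl η.toFinset v) b c} (ω \ ↑DX) * q ^ clusterCount (ω \ ↑DX) ({v, b} : Set V)))) := by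
  by_cases hω : ω ⊆ ↑DX ∪ ↑DY
  swap
  · obtain ⟨e, heω, heD⟩ := Set.not_subset.1 hω
    have h0 := ApexTwoSum.weight_eq_zero_of_mem_not_mem w hw heω heD
    unfold rcWeightW
    rw [h0]; ring
  have jb := glued_b_iff' hab hav hsepD haY hω
  have jv := glued_v_iff' hab hav hsepD haY hω
  have jc := glued_c_iff hac hbc hvc hsepD haY hcX hω
  have jbv := glued_vb_iff hsepD hω
  have hadd := ApexTwoSum.kT_add hsepD hω
  obtain ⟨t1Y, t2Y, t3Y⟩ := ThreeSum.trans_three (a := v) (b := b) (c := c) (ω \ (↑DX : Set (Sym2 V)))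
  have hvS : ω ∈ {η : BondConfig V | b ∉ cl η.toFinset a ∧ c ∉ cl η.toFinset a ∧ Sep (DX ∪ DY) (cl η.toFinset a) b c} → ((ω ∩ ↑DX) ∈ {η : BondConfig V | v ∈ cl η.toFinset a} ∨ ((ω ∩ ↑DX) ∈ {η : BondConfig V | b ∈ cl η.toFinset a} ∧ ((ω ∩ ↑DX) ∈ {η : BondConfig V | b ∈ cl η.toFinset v} ∨ (ω \ ↑DX) ∈ {η : BondConfig V | b ∈ cl η.toFinset v}))) := fun hS => by
    by_contra hnv
    have hv : v ∉ cl ω.toFinset a := fun h => hnv (jv.1 h)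
    exact not_sep_of_not_mem hab hav hsepD haY hω hS.1 hv HY hS.2.2
  have htab : ∀ r : ℝ, (((ω ∩ ↑DX) ∈ {η : BondConfig V | b ∈ cl η.toFinset v} ∨ (ω \ ↑DX) ∈ {η : BondConfig V | b ∈ cl η.toFinset v}) → r = 1) → (¬ ((ω ∩ ↑DX) ∈ {η : BondConfig V | b ∈ cl η.toFinset v} ∨ (ω \ ↑DX) ∈ {η : BondConfig V | b ∈ cl η.toFinset v}) → r = q) →
      ind {η : BondConfig V | b ∉ cl η.toFinset a ∧ c ∉ cl η.toFinset a ∧ Sep (DX ∪ DY) (cl η.toFinset a) b c} ω * r = q * ((ind {η : BondConfig V | b ∉ cl η.toFinset a ∧ v ∈ cl η.toFinset a} (ω ∩ ↑DX)) * (ind {η : BondConfig V | b ∉ cl η.toFinset v ∧ c ∉ cl η.toFinset v ∧ Sep DY (cl η.toFinset v) b c} (ω \ ↑DX))) := by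
    intro r hr1 hrq
    exact table_S (fun h1 h2 => ApexTwoSum.arm_t1 (a := a) (h := b) (t := v) (ω ∩ ↑DX) h2 h1) (fun h1 h2 => ApexTwoSum.arm_t3 (a := a) (h := b) (t := v) (ω ∩ ↑DX) h1 h2)
      (fun h1 h2 => ApexTwoSum.arm_t2 (a := a) (h := b) (t := v) (ω ∩ ↑DX) h1 h2) t1Y t2Y t3Y
      (fun hnb hk => not_sepY_of_mem' (DY := DY) hω hnb hk) hr1 hrq
      (fun hf => ind_of_mem (show ω ∈ {η : BondConfig V | b ∉ cl η.toFinset a ∧ c ∉ cl η.toFinset a ∧ Sep (DX ∪ DY) (cl η.toFinset a) b c} from ⟨fun hb => hf.1 (jb.1 hb), fun hc => hf.2.1 ((jc.1 hc).imp (fun h => ⟨jb.1 h.1, h.2⟩) (fun h => ⟨jv.1 h.1, h.2⟩)), (sep_iff_of_mem hbc hvc hsepD hcX hω (jv.2 hf.2.2.1) (fun hb => hf.1 (jb.1 hb))).2 hf.2.2.2⟩)) (fun hf => ind_of_not_mem (show ω ∉ {η : BondConfig V | b ∉ cl η.toFinset a ∧ c ∉ cl η.toFinset a ∧ Sep (DX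 ∪ DY) (cl η.toFinset a) b c} from fun hS => hf ⟨fun hb => hS.1 (jb.2 hb), fun hc => hS.2.1 (jc.2 (hc.imp (fun h => ⟨jb.2 h.1, h.2⟩) (fun h => ⟨jv.2 h.1, h.2⟩))), hvS hS, (sep_iff_of_mem hbc hvc hsepD hcX hω (jv.2 (hvS hS)) hS.1).1 hS.2.2⟩))
      (fun hh => ind_of_mem hh) (fun hh => ind_of_not_mem hh)
      (fun hh => ind_of_mem hh) (fun hh => ind_of_not_mem hh)
  by_cases hG : b ∈ cl ω.toFinset v
  · have hk := ApexTwoSum.k_of_mem hvb ω hG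
    have hpow : q ^ clusterCount ω ∅ * q ^ clusterCount (∅ : BondConfig V) ({v, b} : Set V) = q ^ clusterCount (ω ∩ ↑DX) ({v, b} : Set V) * q ^ clusterCount (ω \ ↑DX) ({v, b} : Set V) := by
      rw [← pow_add, hk, hadd, pow_add]
    have ht := htab 1 (fun _ => rfl) (fun hn => absurd (jbv.1 hG) hn)
    unfold rcWeightW
    linear_combination (weight (fun e => (w e : ℝ)) ω * ind {η : BondConfig V | b ∉ cl η.toFinset a ∧ c ∉ cl η.toFinset a ∧ Sep (DX ∪ DY) (cl η.toFinset a) b c} ω) * hpow + (weight (fun e => (w e : ℝ)) ω * q ^ clusterCount (ω ∩ ↑DX) ({v, b} : Set V) * q ^ clusterCount (ω \ ↑DX) ({v, b} : Set V)) * ht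
  · have hk := ApexTwoSum.k_of_not_mem hvb ω hG
    have hpow : q ^ clusterCount ω ∅ * q ^ clusterCount (∅ : BondConfig V) ({v, b} : Set V) = q * (q ^ clusterCount (ω ∩ ↑DX) ({v, b} : Set V) * q ^ clusterCount (ω \ ↑DX) ({v, b} : Set V)) := by
      rw [← pow_add, hk, Nat.add_right_comm, hadd, pow_succ, pow_add]; ring
    have ht := htab q (fun hb => absurd (jbv.2 hb) hG) (fun _ => rfl)
    unfold rcWeightW
    linear_combination (weight (fun e => (w e : ℝ)) ω * ind {η : BondConfig V | b ∉ cl η.toFinset a ∧ c ∉ cl η.toFinset a ∧ Sep (DX ∪ DY) (cl η.toFinset a) b c} ω) * hpow + (weight (fun e => (w e : ℝ)) ω * q ^ clusterCount (ω ∩ ↑DX) ({v, b} : Set V) * q ^ clusterCount (ω \ ↑DX) ({v, b} : Set V)) * ht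

end Pointwise

end TerminalTwoSum

end Summit.CriticalPhenomena.PercolationContinuityZ3.Theorems
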